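import Mathlib
import Literature.NumberTheory.EllipticCurves.NonvanishingTwists
import Literature.NumberTheory.DiophantineGeometry.TateAlgorithm
import HarnessLib

/-!
# NonvanishingTwistsPrescribedRamificationAtThree

Topic `Literature/NumberTheory/EllipticCurves`. Named literature fact(s) relocated by the gate from `Summits/BirchSwinnertonDyer/BirchSwinnertonDyer/Theorems/TameQuarticSolventSolventPairLowerBoundTwistDatumOfFriedbergHoffstein.lean`
(accept-time relocation of `[cite]`d propositions written inline in a Summits proposal; human ruling 2026-08-15).
Sources: Deligne1973Constantes, FriedbergHoffstein1995, Kobayashi2002, Nekovar2013.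

* `Literature.NumberTheory.EllipticCurves.friedbergHoffstein_exists_pos_twist_ne_zero_ramifiedAtThree`
-/

namespace Literature.NumberTheory.EllipticCurves

open scoped Classical
open WeierstrassCurve
open Literature.NumberTheory.DiophantineGeometry
open Literature.NumberTheory.EllipticCurves
open Literature.NumberTheory.EllipticCurves.ModularForms

/-- **Non-vanishing quadratic twists in the REAL, `3`-RAMIFIED local class, for a curve of Kodaira type
`III` / `III*` at `3`** (Friedberg–Hoffstein, Ann. of Math. 142 (1995), Thm. B (1), the special case below; its
sign hypothesis is discharged by Kobayashi, Math. Ann. 323 (2002), Thm. 1.1 (ii) and Deligne's product formula).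

FRIEDBERG–HOFFSTEIN THM. B (1) (text not held — acq-00930 is cite-only; paraphrase as in the tree's
`friedbergHoffstein_exists_twist_ne_zero_ramifiedAt` and as used in print by Nekovář, ANT 7 (2013) §3.3,
p. 1112, "[Waldspurger 1991, Theorem 4; Friedberg and Hoffstein 1995, Theorem B.1]"): for a cuspidal
automorphic representation `π` of `GL₂` over a number field `F`, a finite set `S` of places and quadratic
characters `(χ_v)_{v ∈ S}` of the `F_v^×`: if SOME quadratic Hecke character `ξ` with `ξ_v = χ_v` (`v ∈ S`)
has `ε(π ⊗ ξ, 1/2) = +1`, then INFINITELY MANY quadratic `χ` with `χ_v = χ_v⁽⁰⁾` the prescribed local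
components at `v ∈ S` have `L(π ⊗ χ, 1/2) ≠ 0`.

THE SPECIAL CASE. `F = ℚ`, `π = π_E` (`E/ℚ` is modular: Breuil–Conrad–Diamond–Taylor 2001 Thm. A),
`S = {∞} ∪ {ℓ prime : ℓ ∣ N_E}` (so `3 ∈ S`), prescribed components `χ_∞ = 1` (REAL quadratic fields),
`χ₃ =` the character of `ℚ₃(√3)/ℚ₃` (RAMIFIED; `d ∈ 3·ℤ₃^{×2}`), and `χ_ℓ = 1` for `ℓ ∣ N_E`, `ℓ ≠ 3`
(`d ∈ ℚ_ℓ^{×2}`, i.e. `ℓ` SPLIT in `ℚ(√d)`). The square-free integers `d` with `χ_d` in this class are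
exactly: `d > 0`, `3 ∥ d` (with `d/3 ≡ 1 (mod 3)`), `(d/ℓ) = 1` for the odd primes `ℓ ∣ N_E`, `ℓ ≠ 3`, and
`d ≡ 1 (mod 8)` when `2 ∣ N_E`; such `d` exist (Chinese remainder theorem).

THE SIGN HYPOTHESIS HOLDS ON THE WHOLE CLASS when `w(E) = −1` and `E` has potentially good reduction of
Kodaira type `III` or `III*` at `3`. Write `w(E ⊗ χ) = ∏_v w_v(E ⊗ χ_v)` (Deligne 1973 §5; product over all
places, `w_∞ = −1`; for `π_E` the automorphic and Galois local constants agree). Place by place,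
`w_v(E ⊗ χ_v) / w_v(E)` is: `1` at `v = ∞`; `1` at `ℓ ∣ N_E`, `ℓ ≠ 3`, because `χ_ℓ = 1`; `χ_ℓ(−1) = (−1, d)_ℓ`
at `ℓ ∤ 3N_E`, because `π_ℓ = π(μ, μ⁻¹)` is an unramified principal series and
`ε_ℓ(π ⊗ χ_ℓ) = (μχ_ℓ)(−1) = χ_ℓ(−1)` (verbatim the computation of Nekovář 2013, proof of Lemma 3.4,
p. 1112); and `1` at `v = 3`: `E` and `E^{(d)}` BOTH have potentially good reduction over `ℚ₃` (`j` is a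
twist invariant) of Kodaira type `III` or `III*` (a twist with `ord₃ d = 1` swaps `III ↔ III*`; Tate's
algorithm, Silverman *ATAEC* IV.9.4 — tree theorem `SolventPairLowerBound.kodairaSymbolAt_placeOf_three_of_twist`),
so by Kobayashi 2002 Thm. 1.1 (ii) — "If the Kodaira–Néron type of `E` is `III` or `III*`, then
`w(E/K) = (−2/k)`" for ANY local field `K` of odd residue characteristic and `E/K` potentially good — both
local root numbers at `3` equal `(−2/𝔽₃) = (1/3) = +1`. Hence, by Hilbert reciprocity for `(−1, d)`,
`w(E^{(d)}) = w(E) · ∏_{ℓ ∤ 3N_E} (−1,d)_ℓ = w(E) · [(−1,d)_∞ · (−1,d)₃ · ∏_{ℓ ∣ N_E, ℓ ≠ 3} (−1,d)_ℓ]⁻¹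
= w(E) · [(+1) · (−1) · (+1)]⁻¹ = −w(E) = +1` (`d > 0`; `d = 3u` with `u ∈ ℤ₃^×` gives
`(−1, d)₃ = (−1/3) = −1`; `d ∈ ℚ_ℓ^{×2}` at `ℓ ∣ N_E`, `ℓ ≠ 3`). (Structurally: a tame `e = 4` curve at
`p = 3 ≡ 3 (mod 4)` has Weil representation `Ind_{ℚ₉/ℚ₃} θ`, `θ|_{𝔽₉^×}` of order `4`, one isomorphism class
stable under all four quadratic characters of `ℚ₃^×`.) So Thm. B (1) applies and gives infinitely many `d`
in the class with `L(E^{(d)}, 1) ≠ 0`.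

TRANSCRIPTION (tree vocabulary, as `NonvanishingTwists.lean`): `W/ℚ` elliptic with `W.rootNumber = -1`,
`0 ≤ ord₃ j(W)` (`padicValRat 3 W.j`), and `W.kodairaSymbolAt v₃ ∈ {III, III*}` for `v₃` the place of `ℤ`
at `3` (`Rat.HeightOneSpectrum.primesEquiv`); conclusion: for every bound `B` a square-free integer `d > B`
with `padicValInt 3 d = 1`, `jacobiSym d ℓ = 1` for every odd prime `ℓ ∣ N_W = W.conductorNorm ℤ` other
than `3`, `d ≡ 1 (mod 8)` if `2 ∣ N_W`, and `L(W^{(d)}, 1) ≠ 0` (`(W.quadraticTwist d).entireLFunction 1 ≠ 0`).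
Consumed by route `BirchSwinnertonDyer/TameQuarticSolvent`, crux `SolventPairLowerBound`, stub
`stub_twistDatum` (the admissible REAL rank-zero twist, `3`-ramified so that the tame quartic over `ℚ(√d)`
has `e(w ∣ 3) = 4`). Named fact (D-0014); nothing is asserted; users take
`(h : friedbergHoffstein_exists_pos_twist_ne_zero_ramifiedAtThree)`.
-- TODO(general form): Friedberg–Hoffstein Thm. B for any cuspidal `π` on `GL₂/F`, any finite set of
-- places with prescribed quadratic local components, under the hypothesis `∃ ξ, ε(π ⊗ ξ, 1/2) = +1`.
[cite: FriedbergHoffstein1995, Thm. B (1) (special case F = ℚ, S = {∞} ∪ {ℓ ∣ N_E}, χ_∞ = 1, χ₃ ramified, χ_ℓ = 1)]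
[cite: Kobayashi2002, Thm. 1.1 (ii) (p. 610): Kodaira III or III*, potentially good, odd residue characteristic ⇒ w(E/K) = (−2/k)]
[cite: Nekovar2013, §3.3 p. 1112 (use of Waldspurger Thm. 4 / Friedberg–Hoffstein Thm. B.1) and proof of Lemma 3.4 (ε_ℓ(π ⊗ α) = α_ℓ(−1), ε_ℓ unchanged where α_ℓ = 1)]
[cite: Deligne1973Constantes, §5 (local constants; w = ∏_v w_v)]
[file NumberTheory/EllipticCurves/NonvanishingTwistsPrescribedRamificationAtThree] -/
def friedbergHoffstein_exists_pos_twist_ne_zero_ramifiedAtThree : Prop :=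
  ∀ (W : WeierstrassCurve ℚ) [W.IsElliptic], W.rootNumber = -1 → 0 ≤ padicValRat 3 W.j →
    (W.kodairaSymbolAt ((Rat.HeightOneSpectrum.primesEquiv (R := ℤ)).symm ⟨3, Nat.prime_three⟩) =
        Literature.NumberTheory.DiophantineGeometry.KodairaSymbol.III ∨
      W.kodairaSymbolAt ((Rat.HeightOneSpectrum.primesEquiv (R := ℤ)).symm ⟨3, Nat.prime_three⟩) =
        Literature.NumberTheory.DiophantineGeometry.KodairaSymbol.IIIstar) →
    ∀ B : ℕ, ∃ d : ℤ, (B : ℤ) < d ∧ Squarefree d ∧ padicValInt 3 d = 1 ∧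
      (∀ ℓ : ℕ, ℓ.Prime → (ℓ : ℤ) ∣ W.conductorNorm ℤ → ℓ ≠ 2 → ℓ ≠ 3 → jacobiSym d ℓ = 1) ∧
      ((2 : ℤ) ∣ W.conductorNorm ℤ → d % 8 = 1) ∧
      (W.quadraticTwist (d : ℚ)).entireLFunction 1 ≠ 0

end Literature.NumberTheory.EllipticCurves
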